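import Mathlib
import Literature.Analysis.FluidPDE.VorticityStretching
import Summits.NavierStokesRegularity.NavierStokesRegularity.Theorems.ThreadingFluxCentreJetDefs
import Summits.NavierStokesRegularity.NavierStokesRegularity.Theorems.ThreadingFluxCentreJetAnalyticOrder
import Summits.NavierStokesRegularity.NavierStokesRegularity.Theorems.ThreadingFluxCentreJetJetCalculus
import HarnessLib

/-!
# Crux `PoloidalLiouville` (stmt-NavierStokesRegularity-1222, wall W1), crux idea «steady-centre-sieve» (ns-idea-15):
# LOWEST-TERM EXPANSIONS at the centre — the `O(‖y‖ᵏ⁺¹)` bookkeeping for L1 `TriaxialToroidalJetRigidity`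

Support file (`--supports stmt-NavierStokesRegularity-1222`, helper; cell `ns-wall-extremal`, ns-wall-eng-7 g6, 0 kit).
For a field `ω` of class `C^ω` at `x₀` whose diagonal Taylor terms of degree `< k` vanish, with (unnormalised) lowest term
`P y := Dᵏω(x₀)(y,…,y)` and `Pₙ := (k!)⁻¹ P`:
* `sub_lowest_isBigO` — `ω(x₀+y) − Pₙ(y) = O(‖y‖ᵏ⁺¹)`, `isBigO_of_low` — `ω(x₀+y) = O(‖y‖ᵏ)` (ns-wall-eng-5 g6's `taylor_isBigO`);
* `fderiv_sub_fderiv_lowest_isBigO` — the DERIVATIVE version `Dω(x₀+y) − DPₙ(y) = O(‖y‖ᵏ)` in operator norm (Taylor for `Dω`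
  + the jet–derivative exchange `JetCalculus.fderiv_diag_succ`);
* `sub_fderiv_isBigO` — `V(x₀+y) − DV(x₀)y = O(‖y‖²)` for `V` of class `C^ω` with `V(x₀) = 0`, `fderiv_sub_isBigO` —
  `DV(x₀+y) − DV(x₀) = O(‖y‖)`;
* `isBigO_clm_apply` — `‖Φ(y)(v(y))‖`-type products of `O`-estimates;
* ★ `convect_sub_lowest_isBigO` — the LOWEST TERM OF THE CURL OF THE CONVECTIVE TERM: with `S := DV(x₀)`, `V(x₀) = 0`,
  `Dω(x₀+y)[V(x₀+y)] − DV(x₀+y)[ω(x₀+y)] − (DPₙ(y)[Sy] − S Pₙ(y)) = O(‖y‖ᵏ⁺¹)`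
  (by the tree's `curl_convect_self` the left bracket is `curl((V·∇)V)` for divergence-free `V`).

HONEST FRAME: calculus bookkeeping; closes no crux or sketch Prop; `PoloidalLiouville` (1222) and NS regularity OPEN.
-/

-- the summit and its single sub-problem share the name (CONVENTIONS §1)
set_option linter.dupNamespace false

noncomputable section

namespace Summit.NavierStokesRegularity.NavierStokesRegularity.Theorems.PoloidalLiouville.CentreJet.LowestTerm

open Set Function Filter Topology Asymptotics
open scoped ContDiff Nat

section General

variable {E F G : Type*} [NormedAddCommGroup E] [NormedSpace ℝ E] [NormedAddCommGroup F] [NormedSpace ℝ F]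
  [NormedAddCommGroup G] [NormedSpace ℝ G]

omit [NormedAddCommGroup E] [NormedSpace ℝ E] in
/-- Products of `O`-estimates through a continuous-linear-map application: if `Φ = O(g₁)` (operator norm) and `v = O(g₂)`
then `y ↦ Φ(y)(v(y))` is `O(g₁ g₂)`. -/
theorem isBigO_clm_apply {l : Filter E} {Φ : E → F →L[ℝ] G} {v : E → F} {g₁ g₂ : E → ℝ}
    (hΦ : Φ =O[l] g₁) (hv : v =O[l] g₂) : (fun y => Φ y (v y)) =O[l] fun y => g₁ y * g₂ y := by
  obtain ⟨C₁, hC₁⟩ := hΦ.bound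
  obtain ⟨C₂, hC₂⟩ := hv.bound
  obtain ⟨C₁', hC₁', hC₁le⟩ : ∃ C : ℝ, 0 ≤ C ∧ C₁ ≤ C := ⟨max C₁ 0, le_max_right _ _, le_max_left _ _⟩
  refine IsBigO.of_bound (C₁' * C₂) ?_
  filter_upwards [hC₁, hC₂] with y h₁ h₂
  have h₁' : ‖Φ y‖ ≤ C₁' * ‖g₁ y‖ := h₁.trans (by gcongr)
  calc ‖Φ y (v y)‖ ≤ ‖Φ y‖ * ‖v y‖ := ContinuousLinearMap.le_opNorm _ _
    _ ≤ (C₁' * ‖g₁ y‖) * (C₂ * ‖g₂ y‖) := by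
        have hC₂' : 0 ≤ C₂ * ‖g₂ y‖ := (norm_nonneg _).trans h₂
        gcongr
    _ = C₁' * C₂ * ‖g₁ y * g₂ y‖ := by rw [norm_mul]; ring

omit [NormedSpace ℝ E] in
/-- Powers of `‖y‖` compare near `0`: `‖y‖^m = O(‖y‖^n)` for `n ≤ m`. -/
theorem isBigO_norm_pow_of_le {m n : ℕ} (h : n ≤ m) :
    (fun y : E => ‖y‖ ^ m) =O[𝓝 0] fun y : E => ‖y‖ ^ n := by
  refine IsBigO.of_bound' ?_
  filter_upwards [Metric.ball_mem_nhds (0 : E) one_pos] with y hy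
  rw [Metric.mem_ball, dist_zero_right] at hy
  rw [norm_pow, norm_pow, norm_norm]
  exact pow_le_pow_of_le_one (norm_nonneg y) hy.le h

variable [CompleteSpace F]

/-- **Lowest term**: if the diagonal Taylor terms of degree `< k` vanish then
`ω(x₀ + y) − (k!)⁻¹ Dᵏω(x₀)(y,…,y) = O(‖y‖ᵏ⁺¹)`. -/
theorem sub_lowest_isBigO {w : E → F} {x₀ : E} (hω : ContDiffAt ℝ ω w x₀) {k : ℕ}
    (hlow : ∀ n < k, ∀ y : E, iteratedFDeriv ℝ n w x₀ (fun _ => y) = 0) :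
    (fun y : E => w (x₀ + y) - ((k ! : ℝ)⁻¹) • iteratedFDeriv ℝ k w x₀ (fun _ => y))
      =O[𝓝 0] fun y : E => ‖y‖ ^ (k + 1) := by
  have hT := AnalyticOrder.taylor_isBigO hω.analyticAt (k + 1)
  refine hT.congr' (Eventually.of_forall fun y => ?_) EventuallyEq.rfl
  dsimp only
  rw [Finset.sum_range_succ, Finset.sum_eq_zero fun n hn => ?_, zero_add]
  rw [hlow n (Finset.mem_range.mp hn) y, smul_zero]

/-- With vanishing lower terms, `ω(x₀ + y) = O(‖y‖ᵏ)`. -/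
theorem isBigO_of_low {w : E → F} {x₀ : E} (hω : ContDiffAt ℝ ω w x₀) {k : ℕ}
    (hlow : ∀ n < k, ∀ y : E, iteratedFDeriv ℝ n w x₀ (fun _ => y) = 0) :
    (fun y : E => w (x₀ + y)) =O[𝓝 0] fun y : E => ‖y‖ ^ k := by
  have h1 := sub_lowest_isBigO hω hlow
  have h2 : (fun y : E => ((k ! : ℝ)⁻¹) • iteratedFDeriv ℝ k w x₀ (fun _ => y)) =O[𝓝 0] fun y : E => ‖y‖ ^ k := by
    refine IsBigO.of_bound (‖(k ! : ℝ)⁻¹‖ * ‖iteratedFDeriv ℝ k w x₀‖) (Eventually.of_forall fun y => ?_)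
    rw [norm_smul, Real.norm_of_nonneg (by positivity : (0 : ℝ) ≤ ‖y‖ ^ k), mul_assoc]
    gcongr
    exact JetCalculus.norm_diag_le k y
  have h3 := (h1.trans (isBigO_norm_pow_of_le (Nat.le_succ k))).add h2
  simpa using h3

/-- `V(x₀ + y) − DV(x₀) y = O(‖y‖²)` for `V` of class `C^ω` at `x₀` with `V x₀ = 0`. -/
theorem sub_fderiv_isBigO {V : E → F} {x₀ : E} (hV : ContDiffAt ℝ ω V x₀) (h0 : V x₀ = 0) :
    (fun y : E => V (x₀ + y) - fderiv ℝ V x₀ y) =O[𝓝 0] fun y : E => ‖y‖ ^ 2 := by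
  have hT := AnalyticOrder.taylor_isBigO hV.analyticAt 2
  refine hT.congr' (Eventually.of_forall fun y => ?_) EventuallyEq.rfl
  dsimp only
  rw [Finset.sum_range_succ, Finset.sum_range_succ, Finset.sum_range_zero, zero_add]
  simp [h0]

/-- `V(x₀ + y) = O(‖y‖)` under the same hypotheses. -/
theorem isBigO_one_of_zero {V : E → F} {x₀ : E} (hV : ContDiffAt ℝ ω V x₀) (h0 : V x₀ = 0) :
    (fun y : E => V (x₀ + y)) =O[𝓝 0] fun y : E => ‖y‖ ^ 1 := by
  have h1 := (sub_fderiv_isBigO hV h0).trans (isBigO_norm_pow_of_le (E := E) one_le_two)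
  have h2 : (fun y : E => fderiv ℝ V x₀ y) =O[𝓝 0] fun y : E => ‖y‖ ^ 1 :=
    IsBigO.of_bound ‖fderiv ℝ V x₀‖ (Eventually.of_forall fun y => by
      rw [pow_one, Real.norm_of_nonneg (norm_nonneg _)]; exact ContinuousLinearMap.le_opNorm _ _)
  simpa using h1.add h2

/-- `DV(x₀ + y) − DV(x₀) = O(‖y‖)` (operator norm) for `V` of class `C^ω` at `x₀`. -/
theorem fderiv_sub_isBigO {V : E → F} {x₀ : E} (hV : ContDiffAt ℝ ω V x₀) :
    (fun y : E => fderiv ℝ V (x₀ + y) - fderiv ℝ V x₀) =O[𝓝 0] fun y : E => ‖y‖ ^ 1 := by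
  have hD : ContDiffAt ℝ ω (fderiv ℝ V) x₀ := hV.fderiv_right le_top
  have hT := AnalyticOrder.taylor_isBigO hD.analyticAt 1
  refine hT.congr' (Eventually.of_forall fun y => ?_) EventuallyEq.rfl
  dsimp only
  rw [Finset.sum_range_succ, Finset.sum_range_zero, zero_add]
  simp

/-- **Lowest term of the derivative** (operator norm): if the diagonal Taylor terms of `ω` of degree `< k` vanish, then
`Dω(x₀ + y) − D[(k!)⁻¹ Dᵏω(x₀)(·,…,·)](y) = O(‖y‖ᵏ)`. -/
theorem fderiv_sub_fderiv_lowest_isBigO {w : E → F} {x₀ : E} (hω : ContDiffAt ℝ ω w x₀) {k : ℕ}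
    (hlow : ∀ n < k, ∀ y : E, iteratedFDeriv ℝ n w x₀ (fun _ => y) = 0) :
    (fun y : E => fderiv ℝ w (x₀ + y) -
        fderiv ℝ (fun y : E => ((k ! : ℝ)⁻¹) • iteratedFDeriv ℝ k w x₀ (fun _ => y)) y)
      =O[𝓝 0] fun y : E => ‖y‖ ^ k := by
  have hD : ContDiffAt ℝ ω (fun z => fderiv ℝ w z) x₀ := hω.fderiv_right le_top
  have hT := AnalyticOrder.taylor_isBigO hD.analyticAt k
  refine hT.congr' (Eventually.of_forall fun y => ?_) EventuallyEq.rfl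
  dsimp only
  congr 1
  -- the partial Taylor sum of `Dω` of order `< k` is the derivative of the normalised lowest term
  ext e
  rw [sum_apply]
  cases k with
  | zero =>
    simp only [Finset.range_zero, Finset.sum_empty]
    -- `P` is constant for `k = 0`
    have : (fun y : E => ((0 ! : ℝ)⁻¹) • iteratedFDeriv ℝ 0 w x₀ (fun _ => y)) = fun _ => w x₀ := by
      funext y; simp
    rw [this]
    simp
  | succ m =>
    rw [Finset.sum_range_succ, Finset.sum_eq_zero fun n hn => ?_, zero_add]
    · -- the top term
      rw [smul_apply, JetCalculus.diag_fderiv_apply hω m y e]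
      have h1 := JetCalculus.fderiv_diag_succ hω m y e
      -- `fderiv (c • P) = c • fderiv P`
      have h2 : fderiv ℝ (fun y : E => (((m + 1)! : ℝ)⁻¹) • iteratedFDeriv ℝ (m + 1) w x₀ (fun _ => y)) y e =
          (((m + 1)! : ℝ)⁻¹) • fderiv ℝ (fun y : E => iteratedFDeriv ℝ (m + 1) w x₀ (fun _ => y)) y e := by
        rw [fderiv_fun_const_smul (JetCalculus.differentiable_diag (f := w) (x₀ := x₀) (m + 1) y)]
        rfl
      rw [h2, h1, smul_smul]
      congr 1
      rw [Nat.factorial_succ, Nat.cast_mul, mul_inv, Nat.cast_add, Nat.cast_one]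
      field_simp
    · -- lower terms vanish: `D̃ₙ(Dω)(y) e = D̃ₙ(∂ₑω)(y) = (n+1)⁻¹ ∂ₑ D̃ₙ₊₁ω (y) = 0`
      have hn : n < m := Finset.mem_range.mp hn
      rw [smul_apply, JetCalculus.diag_fderiv_apply hω n y e]
      have h1 := JetCalculus.fderiv_diag_succ hω n y e
      have h0 : (fun y : E => iteratedFDeriv ℝ (n + 1) w x₀ (fun _ => y)) = fun _ => 0 := by
        funext z; exact hlow (n + 1) (by omega) z
      have h1' : ((n : ℝ) + 1) • iteratedFDeriv ℝ n (fun z => fderiv ℝ w z e) x₀ (fun _ => y) = 0 := by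
        rw [← h1, h0]; simp
      have h3 : iteratedFDeriv ℝ n (fun z => fderiv ℝ w z e) x₀ (fun _ => y) = 0 := by
        have hne : ((n : ℝ) + 1) ≠ 0 := by positivity
        rcases smul_eq_zero.mp h1' with h | h
        · exact absurd h hne
        · exact h
      rw [h3, smul_zero]

omit [CompleteSpace F] in
/-- The normalised lowest term itself is `O(‖y‖ᵏ)`. -/
theorem lowest_isBigO (w : E → F) (x₀ : E) (k : ℕ) :
    (fun y : E => ((k ! : ℝ)⁻¹) • iteratedFDeriv ℝ k w x₀ (fun _ => y)) =O[𝓝 0] fun y : E => ‖y‖ ^ k := by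
  refine IsBigO.of_bound (‖(k ! : ℝ)⁻¹‖ * ‖iteratedFDeriv ℝ k w x₀‖) (Eventually.of_forall fun y => ?_)
  rw [norm_smul, Real.norm_of_nonneg (by positivity : (0 : ℝ) ≤ ‖y‖ ^ k), mul_assoc]
  gcongr
  exact JetCalculus.norm_diag_le k y

omit [CompleteSpace F] in
/-- The derivative of the normalised lowest term of degree `m+1` is `O(‖y‖ᵐ)` in operator norm. -/
theorem fderiv_lowest_isBigO {w : E → F} {x₀ : E} (hω : ContDiffAt ℝ ω w x₀) (m : ℕ) :
    (fun y : E => fderiv ℝ (fun y : E => (((m + 1) ! : ℝ)⁻¹) • iteratedFDeriv ℝ (m + 1) w x₀ (fun _ => y)) y)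
      =O[𝓝 0] fun y : E => ‖y‖ ^ m := by
  refine IsBigO.of_bound (‖(((m + 1) ! : ℝ)⁻¹)‖ * (((m : ℝ) + 1) * ‖iteratedFDeriv ℝ m (fun z => fderiv ℝ w z) x₀‖))
    (Eventually.of_forall fun y => ?_)
  rw [fderiv_fun_const_smul (JetCalculus.differentiable_diag (f := w) (x₀ := x₀) (m + 1) y), norm_smul,
    Real.norm_of_nonneg (by positivity : (0 : ℝ) ≤ ‖y‖ ^ m), mul_assoc]
  gcongr
  exact JetCalculus.norm_fderiv_diag_succ_le hω m y

omit [CompleteSpace F] in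
/-- The loop term of the normalised lowest term of degree `m+1`, `DPₙ(y)[Sy] − S' Pₙ(y)`, is `O(‖y‖ᵐ⁺¹)`. -/
theorem loopTerm_isBigO {w : E → F} {x₀ : E} (hω : ContDiffAt ℝ ω w x₀) (m : ℕ) (S : E →L[ℝ] E) (S' : F →L[ℝ] F) :
    (fun y : E =>
        fderiv ℝ (fun y : E => (((m + 1) ! : ℝ)⁻¹) • iteratedFDeriv ℝ (m + 1) w x₀ (fun _ => y)) y (S y) -
          S' ((((m + 1) ! : ℝ)⁻¹) • iteratedFDeriv ℝ (m + 1) w x₀ (fun _ => y)))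
      =O[𝓝 0] fun y : E => ‖y‖ ^ (m + 1) := by
  have hS : (fun y : E => S y) =O[𝓝 0] fun y : E => ‖y‖ ^ 1 :=
    IsBigO.of_bound ‖S‖ (Eventually.of_forall fun y => by
      rw [pow_one, Real.norm_of_nonneg (norm_nonneg _)]; exact S.le_opNorm y)
  have h1 := (isBigO_clm_apply (fderiv_lowest_isBigO hω m) hS).trans
    (IsBigO.of_bound' (Eventually.of_forall fun y => by rw [← pow_add]))
  have h2 := (S'.isBigO_comp _ _).trans (lowest_isBigO w x₀ (m + 1))
  exact h1.sub h2

end General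

/-! ### The curl of the convective term at lowest order -/

section Convect

variable {V w : E3 → E3} {x₀ : E3} {k : ℕ}

/-- ★ **Lowest term of `(V·∇)ω − (ω·∇)V`** (the curl of the convective term of a divergence-free field, tree
`curl_convect_self`): for `V`, `ω` of class `C^ω` at `x₀` with `V x₀ = 0`, `S := DV(x₀)`, and the diagonal Taylor terms of `ω`
of degree `< m+1` vanishing, with `Pₙ := ((m+1)!)⁻¹ Dᵐ⁺¹ω(x₀)(y,…,y)`:
`Dω(x₀+y)[V(x₀+y)] − DV(x₀+y)[ω(x₀+y)] − (DPₙ(y)[Sy] − S Pₙ(y)) = O(‖y‖ᵐ⁺²)`. -/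
theorem convect_sub_lowest_isBigO (hV : ContDiffAt ℝ ω V x₀) (hω : ContDiffAt ℝ ω w x₀) (h0 : V x₀ = 0) {m : ℕ}
    (hlow : ∀ n < m + 1, ∀ y : E3, iteratedFDeriv ℝ n w x₀ (fun _ => y) = 0) :
    (fun y : E3 =>
        (fderiv ℝ w (x₀ + y) (V (x₀ + y)) - fderiv ℝ V (x₀ + y) (w (x₀ + y))) -
          (fderiv ℝ (fun y : E3 => (((m + 1) ! : ℝ)⁻¹) • iteratedFDeriv ℝ (m + 1) w x₀ (fun _ => y)) y
              (fderiv ℝ V x₀ y) -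
            fderiv ℝ V x₀ ((((m + 1) ! : ℝ)⁻¹) • iteratedFDeriv ℝ (m + 1) w x₀ (fun _ => y))))
      =O[𝓝 0] fun y : E3 => ‖y‖ ^ (m + 2) := by
  set S := fderiv ℝ V x₀ with hS
  set Pn : E3 → E3 := fun y => (((m + 1) ! : ℝ)⁻¹) • iteratedFDeriv ℝ (m + 1) w x₀ (fun _ => y) with hPn
  -- the four pieces
  have hA := fderiv_sub_fderiv_lowest_isBigO hω hlow          -- `Dω − DPn = O(‖y‖^(m+1))`
  have hB := isBigO_one_of_zero hV h0                          -- `V = O(‖y‖)`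
  have hC := sub_fderiv_isBigO hV h0                           -- `V − Sy = O(‖y‖²)`
  have hD := fderiv_sub_isBigO hV                              -- `DV − S = O(‖y‖)`
  have hE := isBigO_of_low hω hlow                             -- `ω = O(‖y‖^(m+1))`
  have hF := sub_lowest_isBigO hω hlow                         -- `ω − Pn = O(‖y‖^(m+2))`
  -- operator-norm bound on `DPn`: `O(‖y‖^m)`
  have hG : (fun y : E3 => fderiv ℝ Pn y) =O[𝓝 0] fun y : E3 => ‖y‖ ^ m := fderiv_lowest_isBigO hω m
  -- term 1: `(Dω − DPn)[V]`
  have h1 : (fun y : E3 => (fderiv ℝ w (x₀ + y) - fderiv ℝ Pn y) (V (x₀ + y))) =O[𝓝 0] fun y : E3 => ‖y‖ ^ (m + 2) := by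
    have h := isBigO_clm_apply hA hB
    refine h.trans ?_
    refine (IsBigO.of_bound' (Eventually.of_forall fun y => ?_))
    rw [← pow_add]
  -- term 2: `DPn[V − Sy]`
  have h2 : (fun y : E3 => fderiv ℝ Pn y (V (x₀ + y) - S y)) =O[𝓝 0] fun y : E3 => ‖y‖ ^ (m + 2) := by
    have h := isBigO_clm_apply hG hC
    refine h.trans (IsBigO.of_bound' (Eventually.of_forall fun y => ?_))
    rw [← pow_add]
  -- term 3: `(DV − S)[ω]`
  have h3 : (fun y : E3 => (fderiv ℝ V (x₀ + y) - S) (w (x₀ + y))) =O[𝓝 0] fun y : E3 => ‖y‖ ^ (m + 2) := by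
    have h := isBigO_clm_apply hD hE
    refine h.trans (IsBigO.of_bound' (Eventually.of_forall fun y => ?_))
    rw [← pow_add]
    ring_nf
    rfl
  -- term 4: `S[ω − Pn]`
  have h4 : (fun y : E3 => S (w (x₀ + y) - Pn y)) =O[𝓝 0] fun y : E3 => ‖y‖ ^ (m + 2) :=
    (S.isBigO_comp _ _).trans hF
  have h := (h1.add h2).sub (h3.add h4)
  refine h.congr' (Eventually.of_forall fun y => ?_) EventuallyEq.rfl
  simp only [sub_apply, map_sub, hPn]
  abel

end Convect

end Summit.NavierStokesRegularity.NavierStokesRegularity.Theorems.PoloidalLiouville.CentreJet.LowestTerm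

end
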